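import Mathlib.MeasureTheory.Function.Jacobian
import Literature.Geometry.Lorentzian.VolumeChartIntegral
import Literature.Geometry.Riemannian.CanonicalNeighbourhoods
import HarnessLib

/-!
# The area formula, inequality half: `Vol_g(F(S)) ≤ ∫_S 𝒥_F du`

For a `C¹` map `F : ℝᵐ → M` from Euclidean space `ℝᵐ = EuclideanSpace ℝ (Fin m)` into a
Riemannian `m`-manifold `(M, g)` (modelled on `ℝᵐ`, second countable) and a measurable
`S ⊆ ℝᵐ`, WITHOUT any injectivity assumption,

  `Vol_g (F '' S) ≤ ∫⁻_S 𝒥_F(u) du`,   `𝒥_F(u) = √det (g_{F u}(dF_u eᵢ, dF_u eⱼ))_{ij}`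

(`riemVolume_image_le_lintegral_jacobian`), the "image measure ≤ integral of the Jacobian" half
of the area formula (Federer 1969, §3.2.3, §3.2.5, §3.2.46; for injective `F` equality holds).
The pointwise chart identity `𝒥_F(u) = |det D(φ_q ∘ F)(u)| · √det (h_{ij})(φ_q (F u))` for the
extended chart `φ_q` at `q` with `F u ∈ φ_q.source` enters as the hypothesis `hJac`.

## Proof

* `lintegral_image_le_lintegral_abs_det_fderiv_mul` — the density version of Mathlib's
  `MeasureTheory.addHaar_image_le_lintegral_abs_det_fderiv` in a finite-dimensional real vector
  space: `∫⁻_{f '' s} ρ ≤ ∫⁻_s |det f'| · ρ ∘ f` for `f` differentiable on the measurable set `s`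
  and `ρ` measurable (by `Measurable.ennreal_induction` on `ρ`: indicators reduce to the set
  version on `s ∩ f ⁻¹' B`, and both sides are additive resp. pass to monotone limits).
* `riemannianMeasure_image_le_lintegral_chart` — one chart: if `T ⊆ F ⁻¹' (φ_q.source)` then
  `μ_h (F '' T) ≤ (φ_q)_* (μ_h|_{U}) ((φ_q ∘ F) '' T) = (ρ · vol)((φ_q ∘ F) '' T)` by the chart form
  of the Riemannian measure (`map_extChartAt_restrict_riemannianMeasure`,
  `ρ = √det h_{ij}`), and the previous step applies to `f = φ_q ∘ F`.
* `riemannianMeasure_image_le_lintegral` — countably many chart domains cover `M`; disjointify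
  `S ∩ F ⁻¹' (φ_{q_k}.source)`, use `σ`-subadditivity of `μ_h` on the left and additivity of the
  integral on the right.

## References

* H. Federer, *Geometric Measure Theory*, Springer 1969, §3.2.3, §3.2.5 (area formula),
  §3.2.46 (Riemannian manifolds).
* I. Chavel, *Riemannian Geometry: A Modern Introduction*, 2nd ed., CUP 2006, §III.3.
-/

open Bundle Set Function Filter MeasureTheory Manifold
open scoped Manifold ContDiff Topology ENNReal NNReal

noncomputable section

namespace Literature.Geometry.Riemannian

open Lorentzian Lorentzian.PseudoRiemannianMetric

/-! ### The density version of `μ (f '' s) ≤ ∫⁻_s |det f'|` in a vector space -/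

section Density

variable {E : Type*} [NormedAddCommGroup E] [NormedSpace ℝ E] [FiniteDimensional ℝ E]
  [MeasurableSpace E] [BorelSpace E] (μ : Measure E) [μ.IsAddHaarMeasure]
  {s : Set E} {f : E → E} {f' : E → E →L[ℝ] E}

omit [FiniteDimensional ℝ E] in
/-- If `f` is differentiable within a measurable set `s` at every point of `s` (hence continuous on
`s`), then `s ∩ f ⁻¹' B` is measurable for every measurable `B`. [folklore] -/
theorem measurableSet_inter_preimage_of_hasFDerivWithinAt (hs : MeasurableSet s)
    (hf' : ∀ x ∈ s, HasFDerivWithinAt f (f' x) s x) {B : Set E} (hB : MeasurableSet B) :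
    MeasurableSet (s ∩ f ⁻¹' B) := by
  classical
  have hc : ContinuousOn f s := fun x hx ↦ (hf' x hx).continuousWithinAt
  have hu : Measurable (s.piecewise f 0) :=
    hc.measurable_piecewise continuous_zero.continuousOn hs
  have : s ∩ f ⁻¹' B = s ∩ (s.piecewise f 0) ⁻¹' B := by
    ext x
    simp only [mem_inter_iff, mem_preimage]
    constructor
    · rintro ⟨hx, hxB⟩; exact ⟨hx, by rwa [piecewise_eq_of_mem _ _ _ hx]⟩
    · rintro ⟨hx, hxB⟩; exact ⟨hx, by rwa [piecewise_eq_of_mem _ _ _ hx] at hxB⟩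
  rw [this]
  exact hs.inter (hu hB)

/-- **Area formula, inequality half, with a density** (Federer 1969, §3.2.3/§3.2.5, the case of a
map `ℝⁿ → ℝⁿ` and the weight `ρ`): if `f : E → E` is differentiable within a measurable set `s` at
every point of `s`, with derivative `f'`, and `ρ : E → [0, ∞]` is measurable, then
`∫⁻_{f '' s} ρ dμ ≤ ∫⁻_s |det f'(x)| ρ(f x) dμ(x)` for an additive Haar measure `μ`. No injectivity
is assumed (for injective `f` this is Mathlib's equality
`lintegral_image_eq_lintegral_abs_det_fderiv_mul`); the case `ρ = 1` is Mathlib's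
`addHaar_image_le_lintegral_abs_det_fderiv`, from which the general case follows by the monotone
class argument `Measurable.ennreal_induction`. [cite: Federer1969, §3.2.3 and §3.2.5] -/
theorem lintegral_image_le_lintegral_abs_det_fderiv_mul (hs : MeasurableSet s)
    (hf' : ∀ x ∈ s, HasFDerivWithinAt f (f' x) s x) {ρ : E → ℝ≥0∞} (hρ : Measurable ρ) :
    ∫⁻ y in f '' s, ρ y ∂μ ≤ ∫⁻ x in s, ENNReal.ofReal |(f' x).det| * ρ (f x) ∂μ := by
  refine Measurable.ennreal_induction (motive := fun ρ ↦
    ∫⁻ y in f '' s, ρ y ∂μ ≤ ∫⁻ x in s, ENNReal.ofReal |(f' x).det| * ρ (f x) ∂μ) ?_ ?_ ?_ hρ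
  · -- indicators: the set version on `s ∩ f ⁻¹' B`
    intro c B hB
    have hsB : MeasurableSet (s ∩ f ⁻¹' B) :=
      measurableSet_inter_preimage_of_hasFDerivWithinAt hs hf' hB
    have hf'B : ∀ x ∈ s ∩ f ⁻¹' B, HasFDerivWithinAt f (f' x) (s ∩ f ⁻¹' B) x :=
      fun x hx ↦ (hf' x hx.1).mono inter_subset_left
    have h1 : ∫⁻ y in f '' s, B.indicator (fun _ ↦ c) y ∂μ = c * μ (f '' (s ∩ f ⁻¹' B)) := by
      rw [lintegral_indicator_const hB, Measure.restrict_apply hB, image_inter_preimage,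
        inter_comm]
    have h2 : ∫⁻ x in s, ENNReal.ofReal |(f' x).det| * B.indicator (fun _ ↦ c) (f x) ∂μ =
        c * ∫⁻ x in s ∩ f ⁻¹' B, ENNReal.ofReal |(f' x).det| ∂μ := by
      have heq : EqOn (fun x ↦ ENNReal.ofReal |(f' x).det| * B.indicator (fun _ ↦ c) (f x))
          (fun x ↦ (s ∩ f ⁻¹' B).indicator (fun x ↦ c * ENNReal.ofReal |(f' x).det|) x) s := by
        intro x hx
        by_cases hxB : f x ∈ B
        · simp only [indicator_of_mem hxB,
            indicator_of_mem (show x ∈ s ∩ f ⁻¹' B from ⟨hx, hxB⟩), mul_comm]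
        · simp only [indicator_of_notMem hxB,
            indicator_of_notMem (show x ∉ s ∩ f ⁻¹' B from fun h ↦ hxB h.2), mul_zero]
      rw [setLIntegral_congr_fun hs heq, lintegral_indicator hsB, Measure.restrict_restrict hsB,
        inter_eq_left.2 inter_subset_left,
        lintegral_const_mul'' c (aemeasurable_ofReal_abs_det_fderivWithin μ hsB hf'B)]
    rw [h1, h2]
    exact mul_le_mul_right (addHaar_image_le_lintegral_abs_det_fderiv μ hsB hf'B) c
  · -- additivity
    intro ρ₁ ρ₂ _ hρ₁ _ h₁ h₂
    calc ∫⁻ y in f '' s, (ρ₁ + ρ₂) y ∂μ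
        = ∫⁻ y in f '' s, ρ₁ y ∂μ + ∫⁻ y in f '' s, ρ₂ y ∂μ := lintegral_add_left hρ₁ _
      _ ≤ ∫⁻ x in s, ENNReal.ofReal |(f' x).det| * ρ₁ (f x) ∂μ +
            ∫⁻ x in s, ENNReal.ofReal |(f' x).det| * ρ₂ (f x) ∂μ := add_le_add h₁ h₂
      _ ≤ ∫⁻ x in s, (ENNReal.ofReal |(f' x).det| * ρ₁ (f x) +
            ENNReal.ofReal |(f' x).det| * ρ₂ (f x)) ∂μ := le_lintegral_add _ _
      _ = ∫⁻ x in s, ENNReal.ofReal |(f' x).det| * (ρ₁ + ρ₂) (f x) ∂μ := by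
          simp only [Pi.add_apply, mul_add]
  · -- monotone limits
    intro ρs hρs hmono hP
    calc ∫⁻ y in f '' s, (⨆ n, ρs n y) ∂μ
        = ⨆ n, ∫⁻ y in f '' s, ρs n y ∂μ := lintegral_iSup hρs hmono
      _ ≤ ⨆ n, ∫⁻ x in s, ENNReal.ofReal |(f' x).det| * ρs n (f x) ∂μ := iSup_mono hP
      _ ≤ ∫⁻ x in s, ENNReal.ofReal |(f' x).det| * (⨆ n, ρs n (f x)) ∂μ :=
          iSup_le fun n ↦ lintegral_mono fun x ↦
            mul_le_mul_right (le_iSup (fun n ↦ ρs n (f x)) n) _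

end Density

/-! ### One chart -/

section Chart

variable {m : ℕ} {M : Type*} [TopologicalSpace M] [ChartedSpace (EuclideanSpace ℝ (Fin m)) M]
  [IsManifold (𝓡 m) 1 M] [T3Space M] [MeasurableSpace M] [BorelSpace M] {n : ℕ∞ω}
  (h : ContMDiffRiemannianMetric (𝓡 m) n (EuclideanSpace ℝ (Fin m))
    (TangentSpace (𝓡 m) : M → Type _))

omit [IsManifold (𝓡 m) 1 M] [T3Space M] [MeasurableSpace M] [BorelSpace M] in
/-- Countably many extended-chart domains cover a second countable (nonempty) manifold.
[folklore] -/
theorem exists_seq_mem_extChartAt_source [SecondCountableTopology M] [Nonempty M] :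
    ∃ q : ℕ → M, ∀ x : M, ∃ k, x ∈ (extChartAt (𝓡 m) (q k)).source := by
  obtain ⟨s, hsc, hs⟩ := TopologicalSpace.countable_cover_nhds
    (fun x : M ↦ extChartAt_source_mem_nhds (I := 𝓡 m) x)
  have hne : s.Nonempty := by
    by_contra hn
    rw [not_nonempty_iff_eq_empty] at hn
    rw [hn, biUnion_empty] at hs
    exact empty_ne_univ hs
  obtain ⟨q, rfl⟩ := hsc.exists_eq_range hne
  rw [biUnion_range, iUnion_eq_univ_iff] at hs
  exact ⟨q, hs⟩

/-- **Area formula, inequality half, inside one chart.** Let `h` be a Riemannian metric on a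
manifold `M` modelled on `ℝᵐ`, `F : ℝᵐ → M` a `C¹` map, `q : M`, `φ = extChartAt (𝓡 m) q`, and
`T ⊆ F ⁻¹' φ.source` measurable. Then
`μ_h (F '' T) ≤ ∫⁻_T |det D(φ ∘ F)(u)| √det (h_{ij})(φ (F u)) du`:
by the chart form of the Riemannian measure, `φ_* (μ_h|_{φ.source}) = √det(h_{ij}) · vol`
(`map_extChartAt_restrict_riemannianMeasure`; Chavel 2006, (III.3.5)), the left side is at most
`∫⁻_{(φ ∘ F) '' T} √det(h_{ij})`, to which the Euclidean inequality
`lintegral_image_le_lintegral_abs_det_fderiv_mul` applies. Federer 1969, §3.2.3, §3.2.46.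
[cite: Federer1969, §3.2.3 and §3.2.46] -/
theorem riemannianMeasure_image_le_lintegral_chart (q : M) {F : EuclideanSpace ℝ (Fin m) → M}
    (hF : ContMDiff 𝓘(ℝ, EuclideanSpace ℝ (Fin m)) (𝓡 m) 1 F) {T : Set (EuclideanSpace ℝ (Fin m))}
    (hT : MeasurableSet T) (hTq : T ⊆ F ⁻¹' (extChartAt (𝓡 m) q).source) :
    riemannianMeasure h (F '' T) ≤
      ∫⁻ u in T, ENNReal.ofReal |(fderiv ℝ ((extChartAt (𝓡 m) q) ∘ F) u).det| *
        ENNReal.ofReal (Real.sqrt (chartGramMatrix h q ((extChartAt (𝓡 m) q) (F u))).det) := by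
  classical
  have hU : MeasurableSet (extChartAt (𝓡 m) q).source :=
    (isOpen_extChartAt_source q).measurableSet
  have ht : MeasurableSet (extChartAt (𝓡 m) q).target := measurableSet_extChartAt_target q
  -- a measurable modification of the density `√det h_{ij}` off the chart target
  obtain ⟨ρ, hρm, hρ⟩ : ∃ ρ : EuclideanSpace ℝ (Fin m) → ℝ≥0∞, Measurable ρ ∧
      EqOn ρ (fun y ↦ ENNReal.ofReal (Real.sqrt (chartGramMatrix h q y).det))
        (extChartAt (𝓡 m) q).target := by
    refine ⟨(extChartAt (𝓡 m) q).target.piecewise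
      (fun y ↦ ENNReal.ofReal (Real.sqrt (chartGramMatrix h q y).det)) 0, ?_,
      piecewise_eqOn _ _ _⟩
    exact (ENNReal.continuous_ofReal.comp_continuousOn
      (continuousOn_sqrt_det_chartGramMatrix h q)).measurable_piecewise
      continuous_zero.continuousOn ht
  have hρae : (fun y ↦ ENNReal.ofReal (Real.sqrt (chartGramMatrix h q y).det)) =ᵐ[volume.restrict
      (extChartAt (𝓡 m) q).target] ρ := by
    filter_upwards [ae_restrict_mem ht] with y hy
    exact (hρ hy).symm
  have hFT : F '' T ⊆ (extChartAt (𝓡 m) q).source := by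
    rintro _ ⟨u, hu, rfl⟩; exact hTq hu
  -- Step A: through the chart, `μ_h (F '' T) ≤ ∫⁻_{(φ ∘ F) '' T} ρ`
  have hA : riemannianMeasure h (F '' T) ≤ ∫⁻ y in ((extChartAt (𝓡 m) q) ∘ F) '' T, ρ y := by
    calc riemannianMeasure h (F '' T)
        = (riemannianMeasure h).restrict (extChartAt (𝓡 m) q).source (F '' T) := by
          rw [Measure.restrict_apply' hU, inter_eq_left.2 hFT]
      _ ≤ (riemannianMeasure h).restrict (extChartAt (𝓡 m) q).source
            ((extChartAt (𝓡 m) q) ⁻¹' (((extChartAt (𝓡 m) q) ∘ F) '' T)) := by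
          refine measure_mono ?_
          rw [image_comp]
          exact subset_preimage_image _ _
      _ ≤ ((riemannianMeasure h).restrict (extChartAt (𝓡 m) q).source).map (extChartAt (𝓡 m) q)
            (((extChartAt (𝓡 m) q) ∘ F) '' T) :=
          Measure.le_map_apply (aemeasurable_extChartAt_restrict q _) _
      _ = ((volume.restrict (extChartAt (𝓡 m) q).target).withDensity ρ)
            (((extChartAt (𝓡 m) q) ∘ F) '' T) := by
          rw [map_extChartAt_restrict_riemannianMeasure h q, withDensity_congr_ae hρae]
      _ = ∫⁻ y in ((extChartAt (𝓡 m) q) ∘ F) '' T, ρ y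
            ∂(volume.restrict (extChartAt (𝓡 m) q).target) := withDensity_apply' _ _
      _ ≤ ∫⁻ y in ((extChartAt (𝓡 m) q) ∘ F) '' T, ρ y :=
          lintegral_mono' (Measure.restrict_mono subset_rfl Measure.restrict_le_self) le_rfl
  -- Step B: the Euclidean inequality for `f = φ ∘ F` on `T`
  have hderiv : ∀ u ∈ T, HasFDerivWithinAt ((extChartAt (𝓡 m) q) ∘ F)
      (fderiv ℝ ((extChartAt (𝓡 m) q) ∘ F) u) T u := by
    intro u hu
    have hφ : MDifferentiableAt (𝓡 m) 𝓘(ℝ, EuclideanSpace ℝ (Fin m)) (extChartAt (𝓡 m) q) (F u) :=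
      mdifferentiableAt_extChartAt (by rw [← extChartAt_source (𝓡 m)]; exact hTq hu)
    have h1 : MDifferentiableAt 𝓘(ℝ, EuclideanSpace ℝ (Fin m)) 𝓘(ℝ, EuclideanSpace ℝ (Fin m))
        ((extChartAt (𝓡 m) q) ∘ F) u := hφ.comp u (hF.mdifferentiableAt one_ne_zero)
    exact (mdifferentiableAt_iff_differentiableAt.1 h1).hasFDerivAt.hasFDerivWithinAt
  refine hA.trans ((lintegral_image_le_lintegral_abs_det_fderiv_mul volume hT hderiv hρm).trans_eq
    (setLIntegral_congr_fun hT (fun u hu ↦ ?_)))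
  have hy : (extChartAt (𝓡 m) q) (F u) ∈ (extChartAt (𝓡 m) q).target :=
    (extChartAt (𝓡 m) q).map_source (hTq hu)
  simp only [Function.comp_apply, hρ hy]

/-- **Area formula, inequality half, for the Riemannian measure.** Let `h` be a Riemannian metric
on a second countable manifold `M` modelled on `ℝᵐ`, `F : ℝᵐ → M` a `C¹` map, and
`J : ℝᵐ → [0, ∞]` any function dominating the chart Jacobians:
`|det D(φ_q ∘ F)(u)| √det (h_{ij})(φ_q (F u)) ≤ J u` whenever `F u ∈ φ_q.source`
(`φ_q = extChartAt (𝓡 m) q`). Then `μ_h (F '' S) ≤ ∫⁻_S J` for every measurable `S` (no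
injectivity of `F`): cover `M` by countably many chart domains, disjointify the pieces
`S ∩ F ⁻¹' φ_{q_k}.source`, apply `riemannianMeasure_image_le_lintegral_chart` to each and sum
(`σ`-subadditivity on the left, additivity of the integral on the right). Federer 1969, §3.2.3,
§3.2.46. [cite: Federer1969, §3.2.3 and §3.2.46] -/
theorem riemannianMeasure_image_le_lintegral [SecondCountableTopology M]
    {F : EuclideanSpace ℝ (Fin m) → M} (hF : ContMDiff 𝓘(ℝ, EuclideanSpace ℝ (Fin m)) (𝓡 m) 1 F)
    {J : EuclideanSpace ℝ (Fin m) → ℝ≥0∞}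
    (hJ : ∀ (u : EuclideanSpace ℝ (Fin m)) (q : M), F u ∈ (extChartAt (𝓡 m) q).source →
      ENNReal.ofReal |(fderiv ℝ ((extChartAt (𝓡 m) q) ∘ F) u).det| *
        ENNReal.ofReal (Real.sqrt (chartGramMatrix h q ((extChartAt (𝓡 m) q) (F u))).det) ≤ J u)
    {S : Set (EuclideanSpace ℝ (Fin m))} (hS : MeasurableSet S) :
    riemannianMeasure h (F '' S) ≤ ∫⁻ u in S, J u := by
  haveI : Nonempty M := ⟨F 0⟩
  obtain ⟨q, hq⟩ := exists_seq_mem_extChartAt_source (m := m) (M := M)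
  -- the pieces `S ∩ F ⁻¹' (φ_{q k}).source`, disjointified
  have hAm : ∀ k, MeasurableSet (S ∩ F ⁻¹' (extChartAt (𝓡 m) (q k)).source) := fun k ↦
    hS.inter ((isOpen_extChartAt_source (q k)).preimage hF.continuous).measurableSet
  have hAS : (⋃ k, S ∩ F ⁻¹' (extChartAt (𝓡 m) (q k)).source) = S := by
    refine Subset.antisymm (iUnion_subset fun k ↦ inter_subset_left) fun u hu ↦ ?_
    obtain ⟨k, hk⟩ := hq (F u)
    exact mem_iUnion.2 ⟨k, hu, hk⟩
  have hTm : ∀ k,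
      MeasurableSet (disjointed (fun k ↦ S ∩ F ⁻¹' (extChartAt (𝓡 m) (q k)).source) k) :=
    MeasurableSet.disjointed hAm
  have hTS : (⋃ k, disjointed (fun k ↦ S ∩ F ⁻¹' (extChartAt (𝓡 m) (q k)).source) k) = S := by
    rw [iUnion_disjointed, hAS]
  have hTq : ∀ k, disjointed (fun k ↦ S ∩ F ⁻¹' (extChartAt (𝓡 m) (q k)).source) k ⊆
      F ⁻¹' (extChartAt (𝓡 m) (q k)).source := fun k ↦
    (disjointed_subset _ k).trans inter_subset_right
  calc riemannianMeasure h (F '' S)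
      = riemannianMeasure h (⋃ k, F '' disjointed
          (fun k ↦ S ∩ F ⁻¹' (extChartAt (𝓡 m) (q k)).source) k) := by
        rw [← image_iUnion, hTS]
    _ ≤ ∑' k, riemannianMeasure h (F '' disjointed
          (fun k ↦ S ∩ F ⁻¹' (extChartAt (𝓡 m) (q k)).source) k) := measure_iUnion_le _
    _ ≤ ∑' k, ∫⁻ u in disjointed (fun k ↦ S ∩ F ⁻¹' (extChartAt (𝓡 m) (q k)).source) k, J u :=
        ENNReal.tsum_le_tsum fun k ↦
          (riemannianMeasure_image_le_lintegral_chart h (q k) hF (hTm k) (hTq k)).trans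
            (setLIntegral_mono' (hTm k) fun u hu ↦ hJ u (q k) (hTq k hu))
    _ = ∫⁻ u in ⋃ k, disjointed (fun k ↦ S ∩ F ⁻¹' (extChartAt (𝓡 m) (q k)).source) k, J u :=
        (lintegral_iUnion hTm (disjoint_disjointed _) _).symm
    _ = ∫⁻ u in S, J u := by rw [hTS]

end Chart

/-! ### The registered statement -/

section AreaFormula

/-- **The area formula, inequality half** (Federer 1969, §3.2.3, §3.2.5, §3.2.46). Let `(M, g)` be
a Riemannian `m`-manifold modelled on `ℝᵐ = EuclideanSpace ℝ (Fin m)`, `F : ℝᵐ → M` a `C¹` map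
and `S ⊆ ℝᵐ` measurable. Then, WITHOUT injectivity of `F`,
`Vol_g (F '' S) ≤ ∫⁻_S 𝒥_F(u) du`, where
`𝒥_F(u) = √det (g_{F u}(dF_u eᵢ, dF_u eⱼ))_{ij}` is the Gram–Jacobian of `F` in the standard
basis `eᵢ = EuclideanSpace.single i 1`. The chart identity
`𝒥_F(u) = |det D(φ_q ∘ F)(u)| √det (h_{ij})(φ_q (F u))` (`φ_q = extChartAt (𝓡 m) q`,
`F u ∈ φ_q.source`, `h = g.toContMDiffRiemannianMetric hg`) is the hypothesis `hJac`; given it,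
the statement is `riemannianMeasure_image_le_lintegral`. (The binders are those of the registered
stub; `[T2Space M]` is part of the registered signature and is not used.)
[cite: Federer1969, §3.2.3 and §3.2.46] -/
theorem riemVolume_image_le_lintegral_jacobian {m : ℕ} {M : Type*} [TopologicalSpace M] [T2Space M]
    [SecondCountableTopology M] [ChartedSpace (EuclideanSpace ℝ (Fin m)) M] [IsManifold (𝓡 m) ∞ M]
    [T3Space M] [MeasurableSpace M] [BorelSpace M]
    (g : PseudoRiemannianMetric (𝓡 m) ∞ (EuclideanSpace ℝ (Fin m)) (TangentSpace (𝓡 m) : M → Type _))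
    (hg : g.IsRiemannian)
    {F : EuclideanSpace ℝ (Fin m) → M} (hF : ContMDiff 𝓘(ℝ, EuclideanSpace ℝ (Fin m)) (𝓡 m) 1 F)
    (hJac : ∀ (u : EuclideanSpace ℝ (Fin m)) (q : M), F u ∈ (extChartAt (𝓡 m) q).source →
      Real.sqrt (Matrix.det (Matrix.of fun i j : Fin m ↦
        g.val (F u) (mfderiv 𝓘(ℝ, EuclideanSpace ℝ (Fin m)) (𝓡 m) F u (EuclideanSpace.single i (1 : ℝ)))
          (mfderiv 𝓘(ℝ, EuclideanSpace ℝ (Fin m)) (𝓡 m) F u (EuclideanSpace.single j (1 : ℝ))))) =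
      |(fderiv ℝ ((extChartAt (𝓡 m) q) ∘ F) u).det| *
        Real.sqrt (Matrix.det (chartGramMatrix (g.toContMDiffRiemannianMetric hg) q
          ((extChartAt (𝓡 m) q) (F u)))))
    {S : Set (EuclideanSpace ℝ (Fin m))} (hS : MeasurableSet S) :
    g.riemVolume (F '' S) ≤ ∫⁻ u in S, ENNReal.ofReal (Real.sqrt (Matrix.det (Matrix.of fun i j : Fin m ↦
      g.val (F u) (mfderiv 𝓘(ℝ, EuclideanSpace ℝ (Fin m)) (𝓡 m) F u (EuclideanSpace.single i (1 : ℝ)))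
        (mfderiv 𝓘(ℝ, EuclideanSpace ℝ (Fin m)) (𝓡 m) F u (EuclideanSpace.single j (1 : ℝ)))))) := by
  rw [PseudoRiemannianMetric.riemVolume_eq hg]
  refine riemannianMeasure_image_le_lintegral (g.toContMDiffRiemannianMetric hg) hF
    (fun u q hu ↦ ?_) hS
  rw [hJac u q hu, ENNReal.ofReal_mul (abs_nonneg _)]

end AreaFormula

end Literature.Geometry.Riemannian

end
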